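import Summits.Schanuel.Schanuel.Theorems.ZilberEacDoubleCancellingSystem
import Summits.Schanuel.Schanuel.Theorems.ZilberEacDoubleCancellingStep
import Summits.Schanuel.Schanuel.Theorems.ZilberEacDoubleCancellingKey
import HarnessLib

/-!
# The double-cancelling regime: existence of solutions (core)

Zilber's Exponential-Algebraic Closedness, case ladder (host summit Schanuel, cell `pub-schanuel`,
seat 2, gen 15).  THE FAMILY `W = {x₂ = r₀x₀ + r₁x₁ + c, y₀ = x₀ + y₂F₀(y₂), y₁ = x₁ + y₂F₁(y₂)}`
with `r₀r₁ < 0`, `F₀ ≠ 0`, `F₁ ≠ 0`, `e₁ = deg F₁ + 1 < e₀ = deg F₀ + 1` (HANDOFF O59 PLAN).  Along the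
single label `n → ∞` (sign `s = ±1`, branch `j₀` subject to the PHASE HYPOTHESIS
`κ‖a₁‖ ≤ Re(a₁U)`, `U = exp(e₁(i arg(2πi/(r₀a₀s)) + 2πij₀)/e₀)`) BOTH fibres are solved by
cancellation, `xⱼ = −wⱼ(x₂) + ψ(e^{−wⱼ(x₂)})` (`ψ` the cancelling fixed point), and the base value
`x₂ = −2πisn + (τ + 2πij₀ + v)/e₀` is found by `exists_zero_of_perturbed_implicit` applied to the
clean system of `ZilberEacDoubleCancellingSystem` with the super-exponentially small perturbation
`Δ = −μ(r₀ψ(e^{−w₀}) + r₁ψ(e^{−w₁}))` controlled by `doubleCancelling_step`.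

* **`exists_doubleCancelling_core`** — the fixed point `ψ`, a depth sequence `M(n) → ∞` with
  `log n / M(n) → 0`, and `v(n) → 0` such that, for all large `n`, both depths
  `Re wⱼ(v(n)) ≥ M(n)`, `e^{−M(n)}` lies in the domain of `ψ`, and the PLANE EQUATION
  `x₂ = r₀x₀ + r₁x₁ + c` holds with `xⱼ = −wⱼ + ψ(e^{−wⱼ})`.  The unwinding into honest
  exponential points and the growth bookkeeping are in `ZilberEacDoubleCancellingSolutions`.

HONEST FRAMING: an existence theorem for explicit members of an OPEN cell (`ECCell 3 2`);
NOT Schanuel's conjecture; EAC ⇏ SC.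
-/

noncomputable section

open Complex Filter Topology Metric Set

set_option linter.dupNamespace false

namespace Summit.Schanuel.Schanuel.Theorems

section Core

set_option maxHeartbeats 800000 in
/-- **THEOREM (double-cancelling core).**  See the module docstring. (new)
[cite: MantovaMasser2023, §1 p.5 (the open case dim π(V) = 2 in ℂ³×ℂˣ³)] -/
theorem exists_doubleCancelling_core (e₀ e₁ : ℕ) (he₁ : 1 ≤ e₁) (he : e₁ < e₀)
    (A : Fin 2 → ℕ → ℂ) (ha₀ : A 0 (e₀ - 1) ≠ 0) (ha₁ : A 1 (e₁ - 1) ≠ 0)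
    (r₀ r₁ : ℝ) (hr₀ : r₀ ≠ 0) (hsign : r₀ * r₁ < 0) (c : ℂ) {s : ℝ} (hs : s = 1 ∨ s = -1)
    (j₀ : ℕ) {κ : ℝ} (hκ : 0 < κ)
    (hphase : κ * ‖A 1 (e₁ - 1)‖ ≤ (A 1 (e₁ - 1) * exp ((e₁ : ℂ) *
      (((Complex.arg (2 * Real.pi * I / ((r₀ : ℂ) * (A 0 (e₀ - 1) * s))) : ℝ) : ℂ) * I +
        2 * Real.pi * I * (j₀ : ℂ)) / (e₀ : ℂ))).re) :
    ∃ (ψ : ℂ → ℂ) (η : ℝ) (M : ℕ → ℝ) (v : ℕ → ℂ), 0 < η ∧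
      (∀ ε : ℂ, ‖ε‖ < η → ψ ε = ε * exp (ψ ε) ∧ ‖ψ ε‖ ≤ 2 * ‖ε‖) ∧
      (∀ ε : ℂ, ‖ε‖ < η → ∀ w : ℂ, exp (-w) = ε → exp (-w + ψ ε) = (-w + ψ ε) + w) ∧
      Tendsto v atTop (𝓝 0) ∧ Tendsto M atTop atTop ∧
      Tendsto (fun n : ℕ => Real.log n / M n) atTop (𝓝 0) ∧
      ∀ᶠ n : ℕ in atTop,
        let τ : ℂ := Complex.log (2 * Real.pi * I * (n : ℂ) / ((r₀ : ℂ) * (A 0 (e₀ - 1) * s)))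
        let P : ℂ := exp (τ / (e₀ : ℂ)) * exp (2 * Real.pi * I / (e₀ : ℂ)) ^ j₀
        let W : Fin 2 → ℕ → ℂ → ℂ := fun j e w => ∑ i ∈ Finset.range e, A j i * P ^ (i + 1) *
          exp ((((i : ℕ) : ℂ) + 1) * w / (e₀ : ℂ))
        Real.exp (-M n) < η ∧ M n ≤ (W 0 e₀ (v n)).re ∧ M n ≤ (W 1 e₁ (v n)).re ∧
        -(2 * Real.pi * I * (s : ℂ) * (n : ℂ)) + (τ + 2 * Real.pi * I * j₀ + v n) / (e₀ : ℂ) =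
          (r₀ : ℂ) * (-W 0 e₀ (v n) + ψ (exp (-W 0 e₀ (v n)))) +
          (r₁ : ℂ) * (-W 1 e₁ (v n) + ψ (exp (-W 1 e₁ (v n)))) + c := by
  -- constants
  have he₀ : 1 ≤ e₀ := by omega
  have he₁₀ : e₁ ≤ e₀ := he.le
  have heC : (e₀ : ℂ) ≠ 0 := by exact_mod_cast (show e₀ ≠ 0 by omega)
  have heR : (e₀ : ℝ) ≠ 0 := by exact_mod_cast (show e₀ ≠ 0 by omega)
  have hr₀C : (r₀ : ℂ) ≠ 0 := by exact_mod_cast hr₀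
  have h2πI : (2 * Real.pi * I : ℂ) ≠ 0 := Complex.two_pi_I_ne_zero
  set a₀ : ℂ := A 0 (e₀ - 1) with ha₀def
  set a₁ : ℂ := A 1 (e₁ - 1) with ha₁def
  have ha₁pos : 0 < ‖a₁‖ := norm_pos_iff.2 ha₁
  have hsC : (s : ℂ) ≠ 0 := by rcases hs with h | h <;> simp [h]
  have hAs : a₀ * (s : ℂ) ≠ 0 := mul_ne_zero ha₀ hsC
  have hneg : 0 < -r₁ / r₀ := by
    have : -r₁ / r₀ = -(r₀ * r₁) / (r₀ * r₀) := by field_simp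
    rw [this]
    exact div_pos (by linarith) (mul_self_pos.2 hr₀)
  set ω : ℂ := exp (2 * Real.pi * I / (e₀ : ℂ)) with hω
  -- the cancelling fixed point and the clean system
  obtain ⟨ψ, η, hη, hψ, hψsol, hψlip⟩ := exists_cancellingFixedPoint_lipschitz
  obtain ⟨V, C, r, hC, hr, hV, hVclean, hpert⟩ := exists_clean_doubleCancelling e₀ e₁ A a₀ ω j₀
  -- parameters along the label
  set τ : ℕ → ℂ := fun n => Complex.log (2 * Real.pi * I * (n : ℂ) / ((r₀ : ℂ) * (a₀ * s))) with hτ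
  set μ : ℕ → ℂ := fun n => (2 * Real.pi * I * (s : ℂ) * (n : ℂ))⁻¹ with hμ
  set p : ℕ → ℂ × ℂ × ℂ × ℂ := fun n =>
    (μ n * ((τ n + 2 * Real.pi * I * j₀) / (e₀ : ℂ) - c), μ n, exp (-(τ n) / (e₀ : ℂ)),
      μ n * (r₁ : ℂ) * exp ((e₁ : ℂ) * τ n / (e₀ : ℂ))) with hp
  have hplim : Tendsto p atTop (𝓝 0) :=
    tendsto_params_doubleCancelling e₀ he₀ e₁ he hr₀ ha₀ r₁ c s hs j₀
  -- scale data
  set S : ℕ → ℂ := fun n => exp (τ n / (e₀ : ℂ)) with hSdef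
  set P : ℕ → ℂ := fun n => S n * ω ^ j₀ with hPdef
  set W : Fin 2 → ℕ → ℕ → ℂ → ℂ := fun j e n w => ∑ i ∈ Finset.range e, A j i * P n ^ (i + 1) *
    exp ((((i : ℕ) : ℂ) + 1) * w / (e₀ : ℂ)) with hWdef
  set X₀ : ℕ → ℂ := fun n => -(2 * Real.pi * I * (s : ℂ) * (n : ℂ)) + (τ n + 2 * Real.pi * I * j₀) / (e₀ : ℂ)
    with hX₀
  set Q : ℕ → ℝ := fun n => κ / 2 * ‖a₁‖ * ‖S n‖ ^ e₁ with hQ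
  set cmin : ℝ := min 1 (-r₁ / (2 * r₀)) with hcmin
  have hcmin_pos : 0 < cmin := lt_min one_pos (by
    have : -r₁ / (2 * r₀) = (-r₁ / r₀) / 2 := by field_simp
    rw [this]; positivity)
  have hcmin1 : cmin ≤ 1 := min_le_left _ _
  have hcmin2 : cmin ≤ -r₁ / (2 * r₀) := min_le_right _ _
  set M : ℕ → ℝ := fun n => cmin * Q n with hM
  set Sg₀ : ℕ → ℝ := fun n => ∑ i ∈ Finset.range e₀, ‖A 0 i‖ * ‖S n‖ ^ (i + 1) with hSg₀
  set Sg₁ : ℕ → ℝ := fun n => ∑ i ∈ Finset.range e₁, ‖A 1 i‖ * ‖S n‖ ^ (i + 1) with hSg₁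
  set ρ : ℕ → ℝ := fun n => 4 * ‖μ n‖ * (|r₀| + |r₁|) * Real.exp (-M n) with hρ
  set Δ : ℕ → ℂ → ℂ := fun n w => -μ n * ((r₀ : ℂ) * ψ (exp (-W 0 e₀ n w)) +
    (r₁ : ℂ) * ψ (exp (-W 1 e₁ n w))) with hΔ
  -- basic per-`n` facts
  have hμne : ∀ n : ℕ, 1 ≤ n → (2 * Real.pi * I * (s : ℂ) * (n : ℂ)) ≠ 0 := fun n hn =>
    mul_ne_zero (mul_ne_zero h2πI hsC) (by exact_mod_cast (show n ≠ 0 by omega))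
  have hμK : ∀ n : ℕ, 1 ≤ n → (2 * Real.pi * I * (s : ℂ) * (n : ℂ)) * μ n = 1 := fun n hn => by
    rw [hμ]; exact mul_inv_cancel₀ (hμne n hn)
  -- KEY IDENTITY: `(2πisn)·clean(p n, w) = X₀ + w/e₀ + r₀W₀ + r₁W₁ − c`
  have hkey : ∀ n : ℕ, 1 ≤ n → ∀ w : ℂ,
      (2 * Real.pi * I * (s : ℂ) * (n : ℂ)) *
        (-1 + exp w + (p n).1 + (p n).2.1 * w / (e₀ : ℂ) +
          (p n).2.2.1 * (∑ i ∈ Finset.range (e₀ - 1), A 0 i / a₀ * (p n).2.2.1 ^ (e₀ - 2 - i) *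
            ω ^ (j₀ * (i + 1)) * exp ((((i : ℕ) : ℂ) + 1) * w / (e₀ : ℂ))) +
          (p n).2.2.2 * (∑ i ∈ Finset.range e₁, A 1 i * (p n).2.2.1 ^ (e₁ - 1 - i) *
            ω ^ (j₀ * (i + 1)) * exp ((((i : ℕ) : ℂ) + 1) * w / (e₀ : ℂ)))) =
      X₀ n + w / (e₀ : ℂ) + (r₀ : ℂ) * W 0 e₀ n w + (r₁ : ℂ) * W 1 e₁ n w - c := by
    intro n hn w
    exact doubleCancelling_key e₀ e₁ he₀ A ha₀ r₀ r₁ hr₀ c hs j₀ hn w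
  -- EVENTUAL LARGENESS ------------------------------------------------------------------
  have hE1 := hplim.eventually hVclean
  have hE2 := hplim.eventually hpert
  have hVlim : Tendsto (fun n => V (p n)) atTop (𝓝 0) := hV.comp hplim
  have hμnorm : ∀ n : ℕ, 1 ≤ n → ‖μ n‖ = 1 / (2 * Real.pi * n) := by
    intro n hn
    rw [hμ]; simp only
    rw [norm_inv, norm_mul, norm_mul, norm_mul, norm_mul, Complex.norm_I, mul_one, Complex.norm_real,
      Complex.norm_two, Real.norm_of_nonneg Real.pi_pos.le, Complex.norm_real, Complex.norm_natCast,
      Real.norm_eq_abs, show |s| = 1 by rcases hs with h | h <;> simp [h], mul_one, one_div]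
  have hμle : ∀ n : ℕ, 1 ≤ n → ‖μ n‖ ≤ 1 := by
    intro n hn
    have hn' : (1 : ℝ) ≤ n := by exact_mod_cast hn
    have hpos : 0 < 2 * Real.pi * (n : ℝ) := by positivity
    rw [hμnorm n hn, div_le_one hpos]
    nlinarith [Real.two_le_pi]
  have hμpos : ∀ n : ℕ, 1 ≤ n → 0 < ‖μ n‖ := fun n hn =>
    norm_pos_iff.2 (by rw [hμ]; exact inv_ne_zero (hμne n hn))
  -- growth of the scale `‖S n‖`
  have hSlim : Tendsto (fun n => ‖S n‖) atTop atTop := tendsto_normS_atTop hr₀ hAs e₀ he₀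
  have hapos : 0 < cmin * (κ / 2 * ‖a₁‖) := by positivity
  have hdecay : ∀ k : ℕ, Tendsto (fun n : ℕ => (n : ℝ) ^ k *
      Real.exp (-(cmin * (κ / 2 * ‖a₁‖) * ‖S n‖ ^ e₁))) atTop (𝓝 0) := fun k =>
    tendsto_pow_mul_exp_neg_Lambda hr₀ hAs e₀ he₀ e₁ he₁ k hapos
  have hMexp : ∀ n, Real.exp (-M n) = Real.exp (-(cmin * (κ / 2 * ‖a₁‖) * ‖S n‖ ^ e₁)) := by
    intro n; rw [hM, hQ]; simp only; ring_nf
  have hexpM : Tendsto (fun n => Real.exp (-M n)) atTop (𝓝 0) := by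
    have h := hdecay 0
    simp only [pow_zero, one_mul] at h
    simpa only [hMexp] using h
  have hnexpM : Tendsto (fun n : ℕ => (n : ℝ) * Real.exp (-M n)) atTop (𝓝 0) := by
    have h := hdecay 1
    simp only [pow_one] at h
    simpa only [hMexp] using h
  -- (a) `‖S n‖ ≥ 1` and the lower-term domination
  have hA1 : ∀ᶠ n : ℕ in atTop, 1 ≤ ‖S n‖ := hSlim.eventually_ge_atTop 1
  set L₁ : ℝ := ∑ i ∈ Finset.range (e₁ - 1), ‖A 1 i‖ with hL₁
  have hL₁nn : 0 ≤ L₁ := Finset.sum_nonneg fun i _ => norm_nonneg _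
  have hA2 : ∀ᶠ n : ℕ in atTop, 3 * L₁ * ‖S n‖ ^ (e₁ - 1) ≤ κ / 4 * ‖a₁‖ * ‖S n‖ ^ e₁ := by
    filter_upwards [hSlim.eventually_ge_atTop (12 * L₁ / (κ * ‖a₁‖)), hA1] with n hn hn1
    have hL : 3 * L₁ ≤ κ / 4 * ‖a₁‖ * ‖S n‖ := by
      have := (div_le_iff₀ (by positivity)).1 hn
      nlinarith
    calc 3 * L₁ * ‖S n‖ ^ (e₁ - 1) ≤ (κ / 4 * ‖a₁‖ * ‖S n‖) * ‖S n‖ ^ (e₁ - 1) :=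
          mul_le_mul_of_nonneg_right hL (by positivity)
      _ = κ / 4 * ‖a₁‖ * (‖S n‖ ^ (e₁ - 1) * ‖S n‖) := by ring
      _ = κ / 4 * ‖a₁‖ * ‖S n‖ ^ e₁ := by rw [← pow_succ, Nat.sub_add_cancel he₁]
  -- (b) `ρ n → 0` and its consequences
  have hρle : ∀ n : ℕ, 1 ≤ n → ρ n ≤ 4 * (|r₀| + |r₁|) * Real.exp (-M n) := by
    intro n hn
    rw [hρ]; simp only
    have : 0 ≤ (|r₀| + |r₁|) * Real.exp (-M n) := by positivity
    nlinarith [hμle n hn]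
  have hρnn : ∀ n, 0 ≤ ρ n := fun n => by rw [hρ]; positivity
  have hρlim : Tendsto ρ atTop (𝓝 0) := by
    have h := hexpM.const_mul (4 * (|r₀| + |r₁|))
    rw [mul_zero] at h
    refine squeeze_zero' (Eventually.of_forall hρnn) ?_ h
    filter_upwards [eventually_ge_atTop 1] with n hn using hρle n hn
  have hA3 : ∀ᶠ n : ℕ in atTop, ‖V (p n)‖ + C * ρ n ≤ min 1 (κ / 8) := by
    have h := (tendsto_zero_iff_norm_tendsto_zero.1 hVlim).add (hρlim.const_mul C)
    rw [mul_zero, add_zero] at h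
    exact h.eventually (eventually_le_nhds (lt_min one_pos (by positivity)))
  have hA4 : ∀ᶠ n : ℕ in atTop, ρ n ≤ r := hρlim.eventually (eventually_le_nhds hr)
  have hA5 : ∀ᶠ n : ℕ in atTop, Real.exp (-M n) < η := hexpM.eventually (gt_mem_nhds hη)
  -- (c) the coefficient sums are linear in `n`
  set Cq : ℝ := 2 * Real.pi / (|r₀| * ‖a₀ * (s : ℂ)‖) with hCq
  have hCqpos : 0 < Cq := div_pos (by positivity) (mul_pos (abs_pos.2 hr₀) (norm_pos_iff.2 hAs))
  have hSe₀ : ∀ n : ℕ, 1 ≤ n → ‖S n‖ ^ e₀ = Cq * n := by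
    intro n hn
    have hnpos : (0 : ℝ) < n := by exact_mod_cast hn
    have h := norm_S_pow_eq hr₀ hAs e₀ hn e₀
    rw [hSdef]; simp only
    rw [h, div_self (by exact_mod_cast heR), one_mul, Real.exp_add, Real.exp_log hnpos, Real.exp_log hCqpos]
  set SA₀ : ℝ := ∑ i ∈ Finset.range e₀, ‖A 0 i‖ with hSA₀
  set SA₁ : ℝ := ∑ i ∈ Finset.range e₁, ‖A 1 i‖ with hSA₁
  have hSg : ∀ n : ℕ, 1 ≤ n → 1 ≤ ‖S n‖ → Sg₀ n ≤ SA₀ * (Cq * n) ∧ Sg₁ n ≤ SA₁ * (Cq * n) := by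
    intro n hn hS1
    rw [← hSe₀ n hn]
    exact ⟨sum_norm_coeff_pow_le (fun i => A 0 i) le_rfl hS1,
      sum_norm_coeff_pow_le (fun i => A 1 i) he₁₀ hS1⟩
  have hA6 : ∀ᶠ n : ℕ in atTop, 3 * Sg₀ n * (C * ρ n) ≤ 1 := by
    have h := hnexpM.const_mul (3 * SA₀ * Cq * C * (4 * (|r₀| + |r₁|)))
    rw [mul_zero] at h
    filter_upwards [h.eventually (eventually_le_nhds one_pos), eventually_ge_atTop 1, hA1]
      with n hn hn1 hS1
    have h1 := (hSg n hn1 hS1).1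
    have h2 := hρle n hn1
    have hSg₀nn : 0 ≤ Sg₀ n := Finset.sum_nonneg fun i _ => by positivity
    calc 3 * Sg₀ n * (C * ρ n) ≤ 3 * (SA₀ * (Cq * n)) * (C * (4 * (|r₀| + |r₁|) * Real.exp (-M n))) := by
          gcongr
      _ = 3 * SA₀ * Cq * C * (4 * (|r₀| + |r₁|)) * ((n : ℝ) * Real.exp (-M n)) := by ring
      _ ≤ 1 := hn
  have hA7 : ∀ᶠ n : ℕ in atTop, ‖μ n‖ * (18 * (|r₀| * Sg₀ n + |r₁| * Sg₁ n)) * Real.exp (-M n) ≤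
      1 / (2 * C) := by
    have h := hnexpM.const_mul (18 * (|r₀| * SA₀ + |r₁| * SA₁) * Cq)
    rw [mul_zero] at h
    filter_upwards [h.eventually (eventually_le_nhds (by positivity : (0:ℝ) < 1 / (2 * C))),
      eventually_ge_atTop 1, hA1] with n hn hn1 hS1
    obtain ⟨h0, h1⟩ := hSg n hn1 hS1
    calc ‖μ n‖ * (18 * (|r₀| * Sg₀ n + |r₁| * Sg₁ n)) * Real.exp (-M n)
        ≤ 1 * (18 * (|r₀| * (SA₀ * (Cq * n)) + |r₁| * (SA₁ * (Cq * n)))) * Real.exp (-M n) := by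
          gcongr
          exact hμle n hn1
      _ = 18 * (|r₀| * SA₀ + |r₁| * SA₁) * Cq * ((n : ℝ) * Real.exp (-M n)) := by ring
      _ ≤ 1 / (2 * C) := hn
  -- (d) the depth of fibre 0 dominates `log n`
  set L₀ : ℝ := Real.log (2 * Real.pi / (|r₀| * ‖a₀ * (s : ℂ)‖)) with hL₀
  have hreX₀ : ∀ n : ℕ, 1 ≤ n → (X₀ n).re = (L₀ + Real.log n) / e₀ := by
    intro n hn
    have hnpos : (0 : ℝ) < n := by exact_mod_cast hn
    rw [hX₀]; simp only
    rw [Complex.add_re, Complex.neg_re, Complex.div_natCast_re, Complex.add_re, hτ]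
    simp only
    rw [show (2 * Real.pi * I * (n : ℂ) / ((r₀ : ℂ) * (a₀ * (s : ℂ)))) =
      2 * Real.pi * I * (((n : ℝ)) : ℂ) / ((r₀ : ℂ) * (a₀ * (s : ℂ))) by norm_cast,
      re_log_label_quot hnpos hr₀ hAs]
    have h1 : (2 * Real.pi * I * (s : ℂ) * (n : ℂ)).re = 0 := by
      simp [Complex.mul_re, Complex.mul_im]
    have h2 : (2 * Real.pi * I * (j₀ : ℂ)).re = 0 := by
      simp [Complex.mul_re, Complex.mul_im]
    rw [h1, h2]
    ring
  have hΛlog := tendsto_Lambda_div_log_atTop hr₀ hAs e₀ he₀ e₁ he₁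
  set K₀ : ℝ := (|c.re| + |L₀| + 1) / |r₀| + 1 with hK₀
  have hK₀pos : 0 < K₀ := by positivity
  have hA8 : ∀ᶠ n : ℕ in atTop, M n ≤ -r₁ / r₀ * Q n - (|c.re| + |(X₀ n).re| + 1) / |r₀| - 1 := by
    have hcoef : 0 < -r₁ / (2 * r₀) * (κ / 2 * ‖a₁‖) := by
      have : -r₁ / (2 * r₀) = (-r₁ / r₀) / 2 := by field_simp
      rw [this]; positivity
    filter_upwards [hΛlog.eventually_ge_atTop ((1 / |r₀| + K₀) / (-r₁ / (2 * r₀) * (κ / 2 * ‖a₁‖))),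
      eventually_ge_atTop 3] with n hn hn3
    have hn1 : 1 ≤ n := by omega
    have hlog1 : 1 ≤ Real.log n := by
      rw [← Real.log_exp 1]
      refine Real.log_le_log (Real.exp_pos 1) ?_
      have : (3 : ℝ) ≤ n := by exact_mod_cast hn3
      linarith [Real.exp_one_lt_d9]
    have hlogpos : 0 < Real.log n := by linarith
    have hΛ : (1 / |r₀| + K₀) * Real.log n ≤ -r₁ / (2 * r₀) * (κ / 2 * ‖a₁‖) * ‖S n‖ ^ e₁ := by
      -- `hn : bound / coef ≤ Λ / log n`
      have h1 := (le_div_iff₀ hlogpos).1 hn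
      rw [div_mul_eq_mul_div] at h1
      exact (div_le_iff₀' hcoef).1 h1
    have hX : |(X₀ n).re| ≤ |L₀| + Real.log n := by
      rw [hreX₀ n hn1, abs_div, abs_of_pos (by exact_mod_cast (show 0 < e₀ by omega) : (0:ℝ) < e₀)]
      calc |L₀ + Real.log n| / e₀ ≤ |L₀ + Real.log n| / 1 :=
            div_le_div_of_nonneg_left (abs_nonneg _) one_pos (by exact_mod_cast he₀)
        _ ≤ |L₀| + Real.log n := by
            rw [div_one]
            exact (abs_add_le _ _).trans (by rw [abs_of_nonneg hlogpos.le])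
    have hM' : M n ≤ -r₁ / (2 * r₀) * Q n := by
      rw [hM]; simp only
      exact mul_le_mul_of_nonneg_right hcmin2 (by rw [hQ]; positivity)
    have hQdef : Q n = κ / 2 * ‖a₁‖ * ‖S n‖ ^ e₁ := rfl
    have hr₀pos : 0 < |r₀| := abs_pos.2 hr₀
    -- `(|c.re| + |X₀.re| + 1)/|r₀| + 1 ≤ (1/|r₀|) log n + K₀`
    have hRHS : (|c.re| + |(X₀ n).re| + 1) / |r₀| + 1 ≤ 1 / |r₀| * Real.log n + K₀ := by
      rw [hK₀]
      have : (|c.re| + |(X₀ n).re| + 1) / |r₀| ≤ (|c.re| + (|L₀| + Real.log n) + 1) / |r₀| :=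
        div_le_div_of_nonneg_right (by linarith) hr₀pos.le
      have hsplit : (|c.re| + (|L₀| + Real.log n) + 1) / |r₀| =
          (|c.re| + |L₀| + 1) / |r₀| + 1 / |r₀| * Real.log n := by field_simp; ring
      linarith
    have h2 : -r₁ / (2 * r₀) * Q n = -r₁ / r₀ * Q n - -r₁ / (2 * r₀) * Q n := by ring
    have hK : K₀ ≤ K₀ * Real.log n := le_mul_of_one_le_right hK₀pos.le hlog1
    have hΛQ : (1 / |r₀| + K₀) * Real.log n ≤ -r₁ / (2 * r₀) * Q n := by
      rw [hQ]; simp only; linarith [hΛ]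
    have hZ : (1 / |r₀| + K₀) * Real.log n = 1 / |r₀| * Real.log n + K₀ * Real.log n := by ring
    linarith [hΛQ, hRHS, hM', hK, hZ, h2]
  -- MAIN STEP --------------------------------------------------------------------------
  have hmain : ∀ᶠ n : ℕ in atTop, ∃ w : ℂ, ‖w - V (p n)‖ ≤ C * ρ n ∧ Real.exp (-M n) < η ∧
      M n ≤ (W 0 e₀ n w).re ∧ M n ≤ (W 1 e₁ n w).re ∧
      X₀ n + w / (e₀ : ℂ) = (r₀ : ℂ) * (-W 0 e₀ n w + ψ (exp (-W 0 e₀ n w))) +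
        (r₁ : ℂ) * (-W 1 e₁ n w + ψ (exp (-W 1 e₁ n w))) + c := by
    filter_upwards [eventually_ge_atTop 1, hE1, hE2, hA1, hA2, hA3, hA4, hA5, hA6, hA7, hA8]
      with n hn h1 h2 a1 a2 a3 a4 a5 a6 a7 a8
    have hcl : X₀ n + V (p n) / (e₀ : ℂ) + (r₀ : ℂ) * W 0 e₀ n (V (p n)) +
        (r₁ : ℂ) * W 1 e₁ n (V (p n)) = c := by
      have := hkey n hn (V (p n))
      rw [h1, mul_zero] at this
      linear_combination -this
    have hρpos : 0 < ρ n := by rw [hρ]; simp only; have := hμpos n hn; positivity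
    have hM₁ : M n ≤ κ / 2 * ‖a₁‖ * ‖S n‖ ^ e₁ := by
      rw [hM, hQ]; simp only
      have : 0 ≤ κ / 2 * ‖a₁‖ * ‖S n‖ ^ e₁ := by positivity
      nlinarith [hcmin1]
    have hρΔ : 2 * ‖μ n‖ * (|r₀| + |r₁|) * Real.exp (-M n) ≤ ρ n := by
      rw [hρ]; simp only
      have : 0 ≤ ‖μ n‖ * (|r₀| + |r₁|) * Real.exp (-M n) := by positivity
      nlinarith
    obtain ⟨hdepth, hsmall, hlipΔ⟩ := doubleCancelling_step e₀ e₁ he₁ he A r₀ r₁ hr₀ hneg.le c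
      (a₀ * (s : ℂ)) j₀ (κ := κ) hn rfl hphase hψ hψlip (μ n) (X₀ n) hC hρpos a3 hcl a1 a2 hM₁ a8
      a6 a5 hρΔ a7
    obtain ⟨w, hw, hsol⟩ := h2 (ρ n) hρpos a4 (Δ n) hsmall hlipΔ
    rw [mem_closedBall, dist_eq_norm] at hw
    refine ⟨w, hw, a5, (hdepth w (by rwa [mem_closedBall, dist_eq_norm])).1,
      (hdepth w (by rwa [mem_closedBall, dist_eq_norm])).2, ?_⟩
    have hk := hkey n hn w
    have hΔ' : (2 * Real.pi * I * (s : ℂ) * (n : ℂ)) * Δ n w =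
        -((r₀ : ℂ) * ψ (exp (-W 0 e₀ n w)) + (r₁ : ℂ) * ψ (exp (-W 1 e₁ n w))) := by
      rw [hΔ]; simp only
      linear_combination (-((r₀ : ℂ) * ψ (exp (-W 0 e₀ n w)) + (r₁ : ℂ) * ψ (exp (-W 1 e₁ n w)))) *
        hμK n hn
    have h0 : (2 * Real.pi * I * (s : ℂ) * (n : ℂ)) *
        (-1 + exp w + (p n).1 + (p n).2.1 * w / (e₀ : ℂ) +
          (p n).2.2.1 * (∑ i ∈ Finset.range (e₀ - 1), A 0 i / a₀ * (p n).2.2.1 ^ (e₀ - 2 - i) *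
            ω ^ (j₀ * (i + 1)) * exp ((((i : ℕ) : ℂ) + 1) * w / (e₀ : ℂ))) +
          (p n).2.2.2 * (∑ i ∈ Finset.range e₁, A 1 i * (p n).2.2.1 ^ (e₁ - 1 - i) *
            ω ^ (j₀ * (i + 1)) * exp ((((i : ℕ) : ℂ) + 1) * w / (e₀ : ℂ)))) +
        (2 * Real.pi * I * (s : ℂ) * (n : ℂ)) * Δ n w = 0 := by
      rw [← mul_add, hsol, mul_zero]
    rw [hk, hΔ'] at h0
    linear_combination h0
  -- CHOICE AND EXPORTS ---------------------------------------------------------------------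
  classical
  set v : ℕ → ℂ := fun n => if h : ∃ w : ℂ, ‖w - V (p n)‖ ≤ C * ρ n ∧ Real.exp (-M n) < η ∧
      M n ≤ (W 0 e₀ n w).re ∧ M n ≤ (W 1 e₁ n w).re ∧
      X₀ n + w / (e₀ : ℂ) = (r₀ : ℂ) * (-W 0 e₀ n w + ψ (exp (-W 0 e₀ n w))) +
        (r₁ : ℂ) * (-W 1 e₁ n w + ψ (exp (-W 1 e₁ n w))) + c then Classical.choose h else 0 with hv
  have hvspec : ∀ᶠ n : ℕ in atTop, ‖v n - V (p n)‖ ≤ C * ρ n ∧ Real.exp (-M n) < η ∧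
      M n ≤ (W 0 e₀ n (v n)).re ∧ M n ≤ (W 1 e₁ n (v n)).re ∧
      X₀ n + v n / (e₀ : ℂ) = (r₀ : ℂ) * (-W 0 e₀ n (v n) + ψ (exp (-W 0 e₀ n (v n)))) +
        (r₁ : ℂ) * (-W 1 e₁ n (v n) + ψ (exp (-W 1 e₁ n (v n)))) + c := by
    filter_upwards [hmain] with n hn
    have hvn : v n = Classical.choose hn := by rw [hv]; simp only [dif_pos hn]
    rw [hvn]
    exact Classical.choose_spec hn
  refine ⟨ψ, η, M, v, hη, hψ, hψsol, ?_, ?_, ?_, ?_⟩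
  · -- `v → 0`
    rw [tendsto_zero_iff_norm_tendsto_zero]
    have hup : Tendsto (fun n => C * ρ n + ‖V (p n)‖) atTop (𝓝 0) := by
      have h := (hρlim.const_mul C).add (tendsto_zero_iff_norm_tendsto_zero.1 hVlim)
      rw [mul_zero, zero_add] at h
      exact h
    refine squeeze_zero' (Eventually.of_forall fun n => norm_nonneg _) ?_ hup
    filter_upwards [hvspec] with n hn
    calc ‖v n‖ = ‖(v n - V (p n)) + V (p n)‖ := by ring_nf
      _ ≤ ‖v n - V (p n)‖ + ‖V (p n)‖ := norm_add_le _ _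
      _ ≤ C * ρ n + ‖V (p n)‖ := by linarith [hn.1]
  · -- `M → ∞`
    rw [hM]
    refine Tendsto.const_mul_atTop hcmin_pos ?_
    rw [hQ]
    refine Tendsto.const_mul_atTop (by positivity) ?_
    exact (tendsto_pow_atTop (by omega : e₁ ≠ 0)).comp hSlim
  · -- `log n / M n → 0`
    have h := hΛlog.inv_tendsto_atTop
    have h2 : Tendsto (fun n : ℕ => (cmin * (κ / 2 * ‖a₁‖))⁻¹ * (‖S n‖ ^ e₁ / Real.log n)⁻¹) atTop (𝓝 0) := by
      have := h.const_mul (cmin * (κ / 2 * ‖a₁‖))⁻¹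
      rw [mul_zero] at this
      exact this
    refine h2.congr' ?_
    filter_upwards [eventually_ge_atTop 1] with n hn
    rw [hM, hQ]; simp only
    rw [inv_div]
    field_simp
  · filter_upwards [hvspec] with n hn
    exact ⟨hn.2.1, hn.2.2.1, hn.2.2.2.1, by
      have := hn.2.2.2.2
      rw [hX₀] at this
      simp only at this
      linear_combination this⟩

end Core

end Summit.Schanuel.Schanuel.Theorems

end
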